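import Summits.QuantumFields.BalabanUV.T4Continuum.Support.BalabanAveragedCoerciveTower
import Literature.MathematicalPhysics.QuantumFieldTheory.Balaban1983to89.B5DeltaA169

/-!
# T⁴ programme, spine node NE2 (U1a) — the HARD-CONSTRAINT MINIMISER `H = GQ*(QGQ*)⁻¹` and the effective operator
# `Δ_K := (n^d Q_k𝒢Q_kᴴ)⁻¹ − a` at `U = 1`: `⟨B, Δ_K B⟩ = η^d · min {⟨A, (Δ_a − aQ*Q)A⟩ : Q_kA = B}`, attained at `HB`

Eighth generation of the NE2 prover lineage P1 of the cell `pub-balaban`, file 14.  Files 10/12/13 proved, at `U = 1`, the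
geometric η-rate of the averaged covariances `c_k = n^d Q_k𝒢Q_kᴴ` AND of their inverses.  The spine's X8 object is Bałaban's
δ-function effective operator `Δ_k`, [Balaban1984PropagatorsI] (1.65) «⟨B, Δ_kB⟩ = ⟨∂H_kB, ∂H_kB⟩» with (p. 29) «Q_kH_kB = B,
R∂*H_kB = 0, H_kB is a minimum of ½⟨∂A, ∂A⟩ on {A: Q_kA = B, R∂*A = 0}», and [Balaban1984PropagatorsII] (2.35) «A = HB =
GQ*(QGQ*)^{−1}B»; the generating quadratic form is (1.69) «⟨A, Δ_aA⟩ = ⟨A, ∂*∂A⟩ + ⟨A, ∂R∂*A⟩ + a⟨A, Q*QA⟩ = ⟨A, ΔA⟩ −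
⟨A, ∂P∂*A⟩ + a⟨A, Q*QA⟩».  THIS FILE types the dictionary between the inverses of files 10/13 and these objects, as far as
finite-dimensional algebra goes WITHOUT the gauge identity (1.95):

* §1 [folklore] HARD COMPLETING-THE-SQUARE (abstract): for a Hermitian `K` with inverse `G`, any `Q`, and `ci` a Hermitian
  inverse of `QGQᴴ`, every `A` with `QA = B` satisfies `⟨A, KA⟩ = ⟨B, ci B⟩ + ⟨A − A_*, K(A − A_*)⟩`, `A_* = GQᴴ ci B`
  (`hard_square`; `QA_* = B`).
* §2 (Bałaban's objects at `U = 1`, tree vocabulary of the leaf `B5QGQ171Unit`/`B5DeltaA169`): `K = calDa = Δ_a` (=`DeltaA`,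
  «Δ − ∂P∂* + aQ*Q»), `G = calG = 𝒢`, `Q = QvOp = Q_k`, `Q* = QvAdj = n^d Q_kᴴ`, `QGQ* = covB`:
  **`Hk B := 𝒢 Q_kᴴ (n^d covB⁻¹) B`** = «GQ*(QGQ*)^{−1}B» literally; **`QvOp_mulVec_Hk`**: «Q_kH_kB = B»;
  **`Delta0 := calDa − a•(QvAdj QvOp)`** = «∂*∂ + ∂R∂*» = `Lap − ∂·PcT·∂ᴴ` (`Delta0_eq`); **`DeltaK := covB⁻¹ − a•1`**;
  **`form_Delta0_eq`**: for `Q_kA = B`, `⟨A, Δ₀A⟩ = n^d⟨B, Δ_K B⟩ + ⟨A − H B, Δ_a(A − H B)⟩` (exact, in `ℂ`); hence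
  **`re_form_DeltaK_le`** / **`form_Delta0_Hk`**: `⟨B, Δ_K B⟩ = η^d · min_{Q_kA = B} ⟨A, Δ₀A⟩`, the minimum attained at
  `H B` — i.e. `H B` is «a minimum of the form ½⟨A, Δ_aA⟩ − a⟨B, B⟩ under the conditions QA = B» ((1.91)–(1.93) WITHOUT the
  clause «R∂*A = 0»); `DeltaK_mulVec_const`: `Δ_K` kills the constant configurations.
* §3 (the tower, `L ≥ 2`): along the levels `n_k = L^k`, **`DeltaKlev k := (covBlev k)⁻¹ − a•1`** CONVERGES with
  `‖Δ_K^{(k)} − Δ_K^{(∞)}‖ ≤ γ(d,a)⁻²·CQB(d,a)·L^{−k}/(1 − L^{−1})` (`DeltaKlev_tendsto`, from file 13's `covBlev_tendsto`) —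
  the η-RATE of the hard effective operators at `U = 1`, UNCONDITIONAL.
* §4–§5 (v1.1, appended): `Δ₀ ⪰ 0` (the leaf's `calDa_sub_smul_Pk_posSemidef`), hence **`re_form_DeltaK_nonneg`** (`Δ_K ⪰ 0`)
  and **`re_form_DeltaK_le_nsq`** (`Δ_K ≤ γ(d,a)⁻¹ − a` as forms, by `‖B‖²`; Cauchy–Schwarz + `‖covB⁻¹‖ ≤ γ⁻¹`), uniformly in the
  level; `re_form_DeltaKlev_bounds` along the tower.

WHAT IS AND IS NOT IDENTIFIED.  PROVED: `Δ_K = covB⁻¹ − a` is the effective operator of the UNCONSTRAINED-GAUGE hard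
minimisation of the (1.69) form `⟨A, (∂*∂ + ∂R∂*)A⟩` over `{Q_kA = B}`, with minimiser the printed `GQ*(QGQ*)^{−1}B`.  NOT
PROVED (the one remaining identification step, residual (R9.xii) of the cell record sharpened): `Δ_K = Δ_k` of (1.65), which
additionally needs the printed gauge identity (1.95)/(2.34) «R∂*GQ* = 0» (so that `R∂*HB = 0` and the `∂R∂*` term vanishes at
the minimiser, `R` an orthogonal projection) for the CONCRETE lattice operators — in the tree only over abstract operator
data (`B5HkProperties`, `OpData.Laws`), not for `calDa`/`PcT` (the leaf's located residual GAPS G-pv15g4-2).  Given it,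
file 13's `covBlev_tendsto` is verbatim the η-rate of X8 at `U = 1`.

HONEST FRAMING (T4-DAG p. 1).  [folklore] finite-dimensional algebra about the leaf's objects at `U = 1`; statements OURS;
the printed sentences above are quoted for orientation and docstrings only — none is a hypothesis.  `U = 1`, FIXED FINITE
torus, linear layer; NOT `U ≠ 1` (WALL G-an2-4), NOT infinite volume, NOT a mass gap, NOT Clay, NOT summit progress.
HONEST DEPENDENCY: continuum YM on T⁴ ⇐ BetaPertH ∧ nine spine estimates (0/9 proved); BetaPertH ⇐ (D1) ∧ (D4) ∧ CAP+tail;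
G-an2-4 gates asym, D1 and NE2/3/4.  ABSOLUTE RULE kept; no `sorry`.
-/

noncomputable section

open scoped BigOperators ComplexConjugate Matrix ComplexOrder Matrix.Norms.L2Operator Topology
open Finset Filter

namespace Summit.QuantumFields.BalabanUV.T4Continuum.BalabanHardMinimizer

open Literature.MathematicalPhysics.QuantumFieldTheory.Balaban1983to89.B5Prop11Plancherel
open Literature.MathematicalPhysics.QuantumFieldTheory.Balaban1983to89.B5Prop11Inverse
open Literature.MathematicalPhysics.QuantumFieldTheory.Balaban1983to89.B5Prop11Lower
open Literature.MathematicalPhysics.QuantumFieldTheory.Balaban1983to89.B5Block118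
open Literature.MathematicalPhysics.QuantumFieldTheory.Balaban1983to89.B5QGQ171Unit
open Literature.MathematicalPhysics.QuantumFieldTheory.Balaban1983to89.B5DeltaA169
open Literature.MathematicalPhysics.QuantumFieldTheory.Balaban1983to89.B5Action121
open Literature.MathematicalPhysics.QuantumFieldTheory.Balaban1983to89.B5Value126 (PcT)
open Summit.QuantumFields.BalabanUV.T4Continuum.CoerciveInverseTower (Coercive isUnit_of_coercive)
open Summit.QuantumFields.BalabanUV.T4Continuum.BalabanAveragedCoerciveFibre (star_dotProduct_conjTranspose_mulVec)
open Summit.QuantumFields.BalabanUV.T4Continuum.BalabanAveragedCoercive (gammaB gammaB_pos coercive_covB')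
open Summit.QuantumFields.BalabanUV.T4Continuum.BalabanAveragedCoerciveTower (covBlev covBlev_tendsto)
open Summit.QuantumFields.BalabanUV.T4Continuum.BalabanAveragedTowerUnit (one_le_lev')
open Summit.QuantumFields.BalabanUV.T4Continuum.BalabanLineAverage (CQB)
open Literature.MathematicalPhysics.QuantumFieldTheory.Balaban1983to89.B5G183RateUnitTower (lev lev_neZero)

/-! ## §1 Hard completing-the-square (abstract) -/

section Abstract

variable {ι κ : Type*} [Fintype ι] [Fintype κ] [DecidableEq ι] [DecidableEq κ]

omit [DecidableEq ι] in
/-- `⟨x, K y⟩ = ⟨K x, y⟩` for a Hermitian `K`. [folklore] -/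
theorem star_dotProduct_mulVec_of_hermitian {K : Matrix ι ι ℂ} (hK : Kᴴ = K) (x y : ι → ℂ) :
    star x ⬝ᵥ (K *ᵥ y) = star (K *ᵥ x) ⬝ᵥ y := by
  have h := star_dotProduct_conjTranspose_mulVec Kᴴ x y
  rwa [Matrix.conjTranspose_conjTranspose, hK] at h

omit [DecidableEq ι] [DecidableEq κ] in
/-- `⟨Qᴴ v, y⟩ = ⟨v, Q y⟩`. [folklore] -/
theorem star_conjTranspose_mulVec_dotProduct (Q : Matrix κ ι ℂ) (v : κ → ℂ) (y : ι → ℂ) :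
    star (Qᴴ *ᵥ v) ⬝ᵥ y = star v ⬝ᵥ (Q *ᵥ y) := by
  have h := star_dotProduct_conjTranspose_mulVec Qᴴ v y
  rw [Matrix.conjTranspose_conjTranspose] at h
  exact h.symm

omit [DecidableEq ι] in
/-- the hard minimiser hits the constraint: `Q(GQᴴ ci B) = B` when `QGQᴴ·ci = 1`. [folklore] -/
theorem mulVec_hardMin {G : Matrix ι ι ℂ} {Q : Matrix κ ι ℂ} {ci : Matrix κ κ ℂ} (hci : Q * G * Qᴴ * ci = 1)
    (B : κ → ℂ) : Q *ᵥ (G *ᵥ (Qᴴ *ᵥ (ci *ᵥ B))) = B := by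
  rw [Matrix.mulVec_mulVec, Matrix.mulVec_mulVec, Matrix.mulVec_mulVec, hci, Matrix.one_mulVec]

/-- **HARD COMPLETING-THE-SQUARE**: `K` Hermitian with `KG = 1`, `ci` a Hermitian right inverse of `QGQᴴ`, `A_* := GQᴴ ci B`;
then for every `A` with `QA = B`, `⟨A, KA⟩ = ⟨B, ci B⟩ + ⟨A − A_*, K(A − A_*)⟩` (the cross terms vanish because `KA_* =
Qᴴ ci B` pairs with `Q(A − A_*) = 0`). [folklore] -/
theorem hard_square {K G : Matrix ι ι ℂ} (hK : Kᴴ = K) (hKG : K * G = 1) {Q : Matrix κ ι ℂ} {ci : Matrix κ κ ℂ}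
    (hci : Q * G * Qᴴ * ci = 1) (hciH : ciᴴ = ci) (A : ι → ℂ) (B : κ → ℂ) (hA : Q *ᵥ A = B) :
    star A ⬝ᵥ (K *ᵥ A)
      = star B ⬝ᵥ (ci *ᵥ B)
        + star (A - G *ᵥ (Qᴴ *ᵥ (ci *ᵥ B))) ⬝ᵥ (K *ᵥ (A - G *ᵥ (Qᴴ *ᵥ (ci *ᵥ B)))) := by
  set As := G *ᵥ (Qᴴ *ᵥ (ci *ᵥ B)) with hAs
  have hKAs : K *ᵥ As = Qᴴ *ᵥ (ci *ᵥ B) := by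
    rw [hAs, Matrix.mulVec_mulVec, hKG, Matrix.one_mulVec]
  have hQAs : Q *ᵥ As = B := mulVec_hardMin hci B
  have e1 : star A ⬝ᵥ (K *ᵥ As) = star B ⬝ᵥ (ci *ᵥ B) := by
    rw [hKAs, star_dotProduct_conjTranspose_mulVec, hA]
  have e2 : star As ⬝ᵥ (K *ᵥ A) = star B ⬝ᵥ (ci *ᵥ B) := by
    rw [star_dotProduct_mulVec_of_hermitian hK, hKAs, star_conjTranspose_mulVec_dotProduct, hA,
      ← star_dotProduct_mulVec_of_hermitian hciH]
  have e3 : star As ⬝ᵥ (K *ᵥ As) = star B ⬝ᵥ (ci *ᵥ B) := by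
    rw [hKAs, star_dotProduct_conjTranspose_mulVec, hQAs]
  rw [Matrix.mulVec_sub, star_sub, sub_dotProduct, dotProduct_sub, dotProduct_sub, e1, e2, e3]
  ring

end Abstract

/-! ## §2 Bałaban's hard minimiser and the effective operator `Δ_K` at `U = 1` -/

section Concrete

variable {d : ℕ} (n : ℕ) [NeZero n] (hn : 1 ≤ n) (M : Fin d → ℕ) [hM : ∀ μ, NeZero (M μ)] (a : ℝ) (ha : 0 < a)

/-- `Q_k𝒢Q_kᴴ` (b05's `covB`) is invertible (it is `γ(d,a)`-coercive, file 12). [folklore] -/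
theorem isUnit_covB : IsUnit (covB n hn M a ha) :=
  isUnit_of_coercive (gammaB_pos a ha) (coercive_covB' n hn M a ha)

/-- `det(covB)` is a unit. [folklore] -/
theorem isUnit_covB_det : IsUnit (covB n hn M a ha).det :=
  (Matrix.isUnit_iff_isUnit_det _).mp (isUnit_covB n hn M a ha)

/-- the inverse of `QGQ*` in the leaf's normalisation: `cinv = n^d · covB⁻¹ = (Q_k𝒢Q_kᴴ)⁻¹`. [folklore] -/
def cinv : Matrix (Tor M × Fin d) (Tor M × Fin d) ℂ := ((n : ℂ) ^ d) • (covB n hn M a ha)⁻¹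

/-- `(Q_k𝒢Q_kᴴ)·cinv = 1`. [folklore] -/
theorem QGQ_mul_cinv : QvOp n M * calG n hn M a ha * (QvOp n M)ᴴ * cinv n hn M a ha = 1 := by
  rw [cinv, Matrix.mul_smul, ← Matrix.smul_mul, ← covB, Matrix.mul_nonsing_inv _ (isUnit_covB_det n hn M a ha)]

/-- `cinv` is Hermitian. [folklore] -/
theorem cinv_conjTranspose : (cinv n hn M a ha)ᴴ = cinv n hn M a ha := by
  have h : ((covB n hn M a ha)⁻¹)ᴴ = (covB n hn M a ha)⁻¹ := (covB_isHermitian n hn M a ha).inv.eq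
  have hs : star ((n : ℂ) ^ d) = (n : ℂ) ^ d := by
    rw [star_pow, Complex.star_def, Complex.conj_natCast]
  rw [cinv, Matrix.conjTranspose_smul, h, hs]

/-- **BAŁABAN's HARD MINIMISER** «A = HB = GQ*(QGQ*)^{−1}B» in the leaf's vocabulary: `H B = 𝒢 Q_kᴴ (n^d covB⁻¹) B`
(`Q* = n^d Q_kᴴ`, `QGQ* = covB`, the two factors `n^d` combine as written). [cite: Balaban1984PropagatorsII, (2.35) p.228] -/
def Hk (B : Tor M × Fin d → ℂ) : Tor (fine n M) × Fin d → ℂ :=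
  calG n hn M a ha *ᵥ ((QvOp n M)ᴴ *ᵥ (cinv n hn M a ha *ᵥ B))

/-- «Q_kH_kB = B». [cite: Balaban1984PropagatorsI, p.29] -/
theorem QvOp_mulVec_Hk (B : Tor M × Fin d → ℂ) : QvOp n M *ᵥ Hk n hn M a ha B = B :=
  mulVec_hardMin (QGQ_mul_cinv n hn M a ha) B

/-- `Δ_a(HB) = Q_kᴴ (QGQ*)⁻¹ B`: the Euler–Lagrange equation of the hard minimisation (the multiplier is `(QGQ*)⁻¹B`).
[folklore] -/
theorem calDa_mulVec_Hk (B : Tor M × Fin d → ℂ) :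
    calDa n hn M a ha *ᵥ Hk n hn M a ha B = (QvOp n M)ᴴ *ᵥ (cinv n hn M a ha *ᵥ B) := by
  rw [Hk, Matrix.mulVec_mulVec, calDa_mul_calG, Matrix.one_mulVec]

/-- the GAUGE-FIXED CURL FORM of (1.69) without its `aQ*Q` term: `Δ₀ := Δ_a − a•Q*Q` = «∂*∂ + ∂R∂*» = «Δ − ∂P∂*».
[cite: Balaban1984PropagatorsI, (1.69) p.29] -/
def Delta0 : Matrix (Tor (fine n M) × Fin d) (Tor (fine n M) × Fin d) ℂ :=
  calDa n hn M a ha - (a : ℂ) • (QvAdj n M * QvOp n M)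

/-- `Δ₀` IS the printed «Δ − ∂P∂*»: `Lap − ∂·P·∂ᴴ` of the leaf `B5DeltaA169` (`calDa = DeltaA = Lap − ∂P∂ᴴ + a•Q*Q`).
[cite: Balaban1984PropagatorsI, (1.69) p.29, (1.70) p.30] -/
theorem Delta0_eq :
    Delta0 n hn M a ha = Lap n M - GradOp (fine n M) (n : ℂ) * PcT n M (n : ℂ) * (GradOp (fine n M) (n : ℂ))ᴴ := by
  rw [Delta0, calDa_eq_DeltaA, DeltaA, add_sub_cancel_right]

/-- **THE EFFECTIVE OPERATOR OF THE HARD MINIMISATION**: `Δ_K := covB⁻¹ − a•1 = n^{−d}(Q_k𝒢Q_kᴴ)⁻¹·n^{d}… − a` — the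
inverse of the averaged covariance of files 10/12/13, shifted by `a`. [folklore] -/
def DeltaK : Matrix (Tor M × Fin d) (Tor M × Fin d) ℂ :=
  (covB n hn M a ha)⁻¹ - (a : ℂ) • (1 : Matrix (Tor M × Fin d) (Tor M × Fin d) ℂ)

/-- **THE DICTIONARY, EXACT FORM**: for every fine configuration `A` with `Q_kA = B`,
`⟨A, Δ₀A⟩ = n^d·⟨B, Δ_K B⟩ + ⟨A − HB, Δ_a(A − HB)⟩` in `ℂ` (`ℓ²` sums; `n^d·⟨·,·⟩_{ℓ²(T₁)} ↔ η^d Σ_{T_η}`). [folklore] -/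
theorem form_Delta0_eq (A : Tor (fine n M) × Fin d → ℂ) (B : Tor M × Fin d → ℂ) (hA : QvOp n M *ᵥ A = B) :
    star A ⬝ᵥ (Delta0 n hn M a ha *ᵥ A)
      = ((n : ℂ) ^ d) * (star B ⬝ᵥ (DeltaK n hn M a ha *ᵥ B))
        + star (A - Hk n hn M a ha B) ⬝ᵥ (calDa n hn M a ha *ᵥ (A - Hk n hn M a ha B)) := by
  have hsq := hard_square (calDa_isHermitian n hn M a ha).eq (calDa_mul_calG n hn M a ha)
    (QGQ_mul_cinv n hn M a ha) (cinv_conjTranspose n hn M a ha) A B hA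
  have h2 : star A ⬝ᵥ (((a : ℂ) • (QvAdj n M * QvOp n M)) *ᵥ A) = (a : ℂ) * (n : ℂ) ^ d * (star B ⬝ᵥ B) := by
    rw [Matrix.smul_mulVec, ← Matrix.mulVec_mulVec, hA, QvAdj_mulVec, dotProduct_smul, dotProduct_smul,
      star_dotProduct_conjTranspose_mulVec, hA, smul_eq_mul, smul_eq_mul, mul_assoc]
  have h3 : star B ⬝ᵥ (cinv n hn M a ha *ᵥ B) = (n : ℂ) ^ d * (star B ⬝ᵥ ((covB n hn M a ha)⁻¹ *ᵥ B)) := by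
    rw [cinv, Matrix.smul_mulVec, dotProduct_smul, smul_eq_mul]
  have h4 : star B ⬝ᵥ (DeltaK n hn M a ha *ᵥ B)
      = star B ⬝ᵥ ((covB n hn M a ha)⁻¹ *ᵥ B) - (a : ℂ) * (star B ⬝ᵥ B) := by
    rw [DeltaK, Matrix.sub_mulVec, Matrix.smul_mulVec, Matrix.one_mulVec, dotProduct_sub, dotProduct_smul,
      smul_eq_mul]
  rw [Delta0, Matrix.sub_mulVec, dotProduct_sub, hsq, h2, h3, h4, Hk]
  ring

/-- **`⟨B, Δ_K B⟩ ≤ η^d⟨A, Δ₀A⟩` for every `A` with `Q_kA = B`** (real parts; `Δ_a ≥ 0`). [folklore] -/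
theorem re_form_DeltaK_le (A : Tor (fine n M) × Fin d → ℂ) (B : Tor M × Fin d → ℂ) (hA : QvOp n M *ᵥ A = B) :
    (n : ℝ) ^ d * (star B ⬝ᵥ (DeltaK n hn M a ha *ᵥ B)).re ≤ (star A ⬝ᵥ (Delta0 n hn M a ha *ᵥ A)).re := by
  have h := congrArg Complex.re (form_Delta0_eq n hn M a ha A B hA)
  have hsq : 0 ≤ (star (A - Hk n hn M a ha B) ⬝ᵥ (calDa n hn M a ha *ᵥ (A - Hk n hn M a ha B))).re :=
    form_re_nonneg_of_posSemidef (calDa_posSemidef n hn M a ha) _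
  have e : (((n : ℂ) ^ d) * (star B ⬝ᵥ (DeltaK n hn M a ha *ᵥ B))).re
      = (n : ℝ) ^ d * (star B ⬝ᵥ (DeltaK n hn M a ha *ᵥ B)).re := by
    rw [show ((n : ℂ) ^ d) = (((n : ℝ) ^ d : ℝ) : ℂ) by push_cast; rfl, Complex.re_ofReal_mul]
  rw [Complex.add_re, e] at h
  linarith

/-- **THE MINIMUM IS ATTAINED AT `HB`**: `η^d⟨HB, Δ₀ HB⟩ = ⟨B, Δ_K B⟩` exactly — so `⟨B, Δ_K B⟩ = η^d · min {⟨A, Δ₀A⟩ :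
Q_kA = B}` and `HB` is «a minimum of the form ½⟨A, Δ_aA⟩ − a⟨B, B⟩ under the conditions QA = B» (the clause «R∂*A = 0» of
(1.91)–(1.93) is not used and not certified here). [cite: Balaban1984PropagatorsI, (1.91)-(1.93) p.33 (statement ours)] -/
theorem form_Delta0_Hk (B : Tor M × Fin d → ℂ) :
    star (Hk n hn M a ha B) ⬝ᵥ (Delta0 n hn M a ha *ᵥ Hk n hn M a ha B)
      = ((n : ℂ) ^ d) * (star B ⬝ᵥ (DeltaK n hn M a ha *ᵥ B)) := by
  rw [form_Delta0_eq n hn M a ha _ B (QvOp_mulVec_Hk n hn M a ha B), sub_self, Matrix.mulVec_zero, dotProduct_zero,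
    add_zero]

/-- `Δ_K` kills the constant configurations `B(y,μ) = c_μ` (`covB c = a⁻¹c`, so `covB⁻¹c = a c`): the zero modes of the
effective operator, consistent with the printed two-sided bound (1.67) by `⟨∂₁B, ∂₁B⟩`. [folklore] -/
theorem DeltaK_mulVec_const (c : Fin d → ℂ) :
    DeltaK n hn M a ha *ᵥ (fun b : Tor M × Fin d => c b.2) = 0 := by
  have ha0 : (a : ℂ) ≠ 0 := by exact_mod_cast ha.ne'
  have h1 : covB n hn M a ha *ᵥ ((a : ℂ) • fun b : Tor M × Fin d => c b.2) = fun b : Tor M × Fin d => c b.2 := by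
    rw [Matrix.mulVec_smul, covB_mulVec_const, smul_smul, mul_inv_cancel₀ ha0, one_smul]
  have h2 : (covB n hn M a ha)⁻¹ *ᵥ (fun b : Tor M × Fin d => c b.2) = (a : ℂ) • fun b : Tor M × Fin d => c b.2 := by
    conv_lhs => rw [← h1]
    rw [Matrix.mulVec_mulVec, Matrix.nonsing_inv_mul _ (isUnit_covB_det n hn M a ha), Matrix.one_mulVec]
  rw [DeltaK, Matrix.sub_mulVec, h2, Matrix.smul_mulVec, Matrix.one_mulVec, sub_self]

end Concrete

/-! ## §3 The tower of hard effective operators along the levels `L^k` and its η-rate -/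

section Tower

variable {d : ℕ} (L : ℕ) [NeZero L] (M : Fin d → ℕ) [hM : ∀ μ, NeZero (M μ)] (a : ℝ) (ha : 0 < a)

/-- the hard effective operators along the tower: `Δ_K^{(k)} = (covB (L^k))⁻¹ − a•1` on the FIXED carrier `Tor M × Fin d`.
[folklore] -/
def DeltaKlev (k : ℕ) : Matrix (Tor M × Fin d) (Tor M × Fin d) ℂ :=
  (covBlev L M a ha k)⁻¹ - (a : ℂ) • (1 : Matrix (Tor M × Fin d) (Tor M × Fin d) ℂ)

/-- `Δ_K^{(k)}` is file 14's `DeltaK` at level `n = L^k` (definitional bookkeeping). [folklore] -/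
theorem DeltaKlev_eq (k : ℕ) : DeltaKlev L M a ha k = DeltaK (lev L k) (one_le_lev' L k) M a ha := rfl

/-- **THE η-RATE OF THE HARD EFFECTIVE OPERATORS AT `U = 1`** (`L ≥ 2`, UNCONDITIONAL): `Δ_K^{(k)} → Δ_K^{(∞)} = c_∞⁻¹ − a`
with `‖Δ_K^{(k)} − Δ_K^{(∞)}‖ ≤ γ(d,a)⁻²·CQB(d,a)·L^{−k}/(1 − L^{−1})` (the shift by `a` cancels in the differences).
[folklore] -/
theorem DeltaKlev_tendsto (hL : 2 ≤ L) :
    ∃ Dinf : Matrix (Tor M × Fin d) (Tor M × Fin d) ℂ,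
      Tendsto (DeltaKlev L M a ha) atTop (𝓝 Dinf) ∧
      ∀ k, ‖DeltaKlev L M a ha k - Dinf‖ ≤ ((gammaB d a)⁻¹) ^ 2 * (CQB d a * ((L : ℝ)⁻¹) ^ k / (1 - (L : ℝ)⁻¹)) := by
  obtain ⟨cinf, -, -, -, hti, hb⟩ := covBlev_tendsto L M a ha hL
  refine ⟨cinf⁻¹ - (a : ℂ) • 1, ?_, fun k => ?_⟩
  · exact hti.sub tendsto_const_nhds
  · rw [DeltaKlev, sub_sub_sub_cancel_right]
    exact hb k

end Tower

/-! ## §4 (v1.1) `Δ_K` is a positive effective operator, bounded above uniformly in the level -/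

section Positivity

variable {d : ℕ} (n : ℕ) [NeZero n] (hn : 1 ≤ n) (M : Fin d → ℕ) [hM : ∀ μ, NeZero (M μ)] (a : ℝ) (ha : 0 < a)

/-- `Δ₀ = Δ_a − a·Pk` with the leaf's `Pk = n^d·Q_kᴴQ_k = Q*Q`. [folklore] -/
theorem Delta0_eq_sub_Pk : Delta0 n hn M a ha = calDa n hn M a ha - (a : ℂ) • Pk n M := by
  rw [Delta0, QvAdj, Matrix.smul_mul, Pk]

/-- `Δ₀ = «Δ − ∂P∂*» ⪰ 0` (the leaf's `calDa_sub_smul_Pk_posSemidef`). [cite: Balaban1984PropagatorsI, (1.69) p.29, p.30] -/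
theorem Delta0_posSemidef : (Delta0 n hn M a ha).PosSemidef := by
  rw [Delta0_eq_sub_Pk]
  exact calDa_sub_smul_Pk_posSemidef n hn M a ha

/-- **`Δ_K ⪰ 0`**: `Re⟨B, Δ_K B⟩ = η^d·Re⟨HB, Δ₀HB⟩ ≥ 0` — the hard effective operator is a positive form (with the constants as
zero modes, `DeltaK_mulVec_const`). [folklore] -/
theorem re_form_DeltaK_nonneg (B : Tor M × Fin d → ℂ) : 0 ≤ (star B ⬝ᵥ (DeltaK n hn M a ha *ᵥ B)).re := by
  have h0 := form_re_nonneg_of_posSemidef (Delta0_posSemidef n hn M a ha) (Hk n hn M a ha B)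
  rw [form_Delta0_Hk, show ((n : ℂ) ^ d) = (((n : ℝ) ^ d : ℝ) : ℂ) by push_cast; rfl, Complex.re_ofReal_mul] at h0
  have hpos : (0 : ℝ) < (n : ℝ) ^ d := pow_pos (by exact_mod_cast Nat.pos_of_ne_zero (NeZero.ne n)) d
  exact (mul_nonneg_iff_of_pos_left hpos).mp h0

/-- `Re⟨B, covB⁻¹B⟩ ≤ γ(d,a)⁻¹·‖B‖²` (Cauchy–Schwarz and `‖covB⁻¹‖ ≤ γ⁻¹` from coercivity). [folklore] -/
theorem re_form_covB_inv_le (B : Tor M × Fin d → ℂ) :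
    (star B ⬝ᵥ ((covB n hn M a ha)⁻¹ *ᵥ B)).re ≤ (gammaB d a)⁻¹ * nsq B := by
  have hγ := gammaB_pos (d := d) a ha
  have h1 : (star B ⬝ᵥ ((covB n hn M a ha)⁻¹ *ᵥ B)).re
      ≤ Real.sqrt (nsq B) * Real.sqrt (nsq ((covB n hn M a ha)⁻¹ *ᵥ B)) :=
    (Complex.re_le_norm _).trans (norm_star_dotProduct_le B _)
  have h2 : Real.sqrt (nsq ((covB n hn M a ha)⁻¹ *ᵥ B)) ≤ ‖(covB n hn M a ha)⁻¹‖ * Real.sqrt (nsq B) :=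
    sqrt_nsq_mulVec_le _ B
  have h3 : ‖(covB n hn M a ha)⁻¹‖ ≤ (gammaB d a)⁻¹ :=
    CoerciveInverseTower.opNorm_inv_le_of_coercive hγ (coercive_covB' n hn M a ha)
  have hs := Real.sqrt_nonneg (nsq B)
  calc (star B ⬝ᵥ ((covB n hn M a ha)⁻¹ *ᵥ B)).re
      ≤ Real.sqrt (nsq B) * (‖(covB n hn M a ha)⁻¹‖ * Real.sqrt (nsq B)) := h1.trans (mul_le_mul_of_nonneg_left h2 hs)
    _ = ‖(covB n hn M a ha)⁻¹‖ * nsq B := by rw [mul_left_comm, Real.mul_self_sqrt (nsq_nonneg B)]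
    _ ≤ (gammaB d a)⁻¹ * nsq B := mul_le_mul_of_nonneg_right h3 (nsq_nonneg B)

/-- **`Δ_K ≤ γ(d,a)⁻¹ − a` as forms**: `Re⟨B, Δ_K B⟩ ≤ (γ(d,a)⁻¹ − a)·‖B‖²`, uniformly in the level `n`, the torus `M` (an UPPER
bound of (1.67)-type but by `‖B‖²`, not by the printed `⟨∂₁B, ∂₁B⟩`; constant ours). [folklore] -/
theorem re_form_DeltaK_le_nsq (B : Tor M × Fin d → ℂ) :
    (star B ⬝ᵥ (DeltaK n hn M a ha *ᵥ B)).re ≤ ((gammaB d a)⁻¹ - a) * nsq B := by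
  have h := re_form_covB_inv_le n hn M a ha B
  have e : (star B ⬝ᵥ (DeltaK n hn M a ha *ᵥ B)).re = (star B ⬝ᵥ ((covB n hn M a ha)⁻¹ *ᵥ B)).re - a * nsq B := by
    rw [DeltaK, Matrix.sub_mulVec, Matrix.smul_mulVec, Matrix.one_mulVec, dotProduct_sub, dotProduct_smul, smul_eq_mul,
      Complex.sub_re, star_dotProduct_self, ← Complex.ofReal_mul, Complex.ofReal_re]
  rw [e, sub_mul]
  linarith

end Positivity

/-! ## §5 (v1.1) The same bounds along the tower -/

section TowerBounds

variable {d : ℕ} (L : ℕ) [NeZero L] (M : Fin d → ℕ) [hM : ∀ μ, NeZero (M μ)] (a : ℝ) (ha : 0 < a)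

/-- `0 ≤ Re⟨B, Δ_K^{(k)}B⟩ ≤ (γ(d,a)⁻¹ − a)·‖B‖²` at every level `k` (uniform two-sided form bounds for the converging tower of
§3). [folklore] -/
theorem re_form_DeltaKlev_bounds (k : ℕ) (B : Tor M × Fin d → ℂ) :
    0 ≤ (star B ⬝ᵥ (DeltaKlev L M a ha k *ᵥ B)).re ∧
      (star B ⬝ᵥ (DeltaKlev L M a ha k *ᵥ B)).re ≤ ((gammaB d a)⁻¹ - a) * nsq B :=
  ⟨re_form_DeltaK_nonneg (lev L k) (one_le_lev' L k) M a ha B, re_form_DeltaK_le_nsq (lev L k) (one_le_lev' L k) M a ha B⟩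

end TowerBounds

end Summit.QuantumFields.BalabanUV.T4Continuum.BalabanHardMinimizer
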